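import Literature.AnabelianGeometry.EtaleTheta.Discharge.Sec1ZHatFiniteIndexCharacteristic
import Literature.AnabelianGeometry.EtaleTheta.Discharge.Sec1DeltaYuuEllZHat
import Literature.AnabelianGeometry.EtaleTheta.Discharge.Sec2CLevelThetaTriviality
import Literature.AnabelianGeometry.EtaleTheta.Thm16SubdagCompanion
import Literature.IUT.HodgeArakelov.CoreTowerFlPMQuotient
import HarnessLib

/-!
# [IUTchII] Rmk. 1.1.1 (iv) / [EtTh] §2: the conjugation action of `Π^tp_C` on `Δ^ell_Y(M) = (Δ^tp_{Y̲̲})^ell` is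
# well defined — `(Δ^tp_{Y̲̲})^ell ⊆ (Δ^tp_Y)^ell ≅ Ẑ` is stable under every automorphism induced by `Π^tp_C`

Mochizuki, *Inter-universal Teichmüller theory II*, §1, Remark 1.1.1 (iv), kurims manuscript (Dec. 2020) p. 23
l. 41–49: «one may regard the commutator map of (iii) as a map `[-,-] : (Δ_X(M)/Δ_Y(M)) × Δ^ell_Y(M) → Π_M|_{(l·Δ_Θ)(M)}`
for which both the domain and the codomain are equipped with natural actions by `Π_C(M)`» [claim: Mochizuki2012, status:
disputed] (IUTchII §1 Rmk 1.1.1 (iv), kurims p.23); [EtTh] §1 p. 13 («`(Δ^tp_Y)^ell ≅ Ẑ(1)`»), §2 Def. 2.7 p. 41 («`Y̲̲ → Y`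
of degree `l`») [cite: MochizukiEtTh2009, Def 2.7 p.41].

Cell abc-iut, seat abc-iut-w4-d018 (gen 7), GAP row **G-w4d018-1** (commutator-equivariance packaging of
`FlSymmetry` at the genuine frame), helper (E). PROOF-ONLY (0 `def` / `instance` / `structure`); dot-notation extensions
of abc-iut-L2-d3's `MuTwoSetting.CLevelData` and abc-iut-L2-t8's `EtaleThetaData.DoubleUnderline` declared by absolute
namespace (lean/CONVENTIONS.md §2). WHAT IS PROVED (pure group theory inside `Π^tp_C`, binders BY NAME):

* `conjX_mem_GtpY_iff` / `conjX_mem_dtpY_iff` — under the (R1c) clause `hR1c` («the inversion acts by `−1` on `Z`»,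
  abc-iut-w5-d072's shape) `Π^tp_Y = Ker(toZ)` and `Δ^tp_Y` are carried onto themselves by every restricted inner
  automorphism `conjX g` of `Π^tp_C` (abc-iut-w4-d019's `toZ_conjX_of_(not_)mem_range`);
* `conjX_mem_ker_toEll` / `toEll_conjX_eq_of_toEll_eq` — `Ker(Π^tp_X ↠ (Π^tp_X)^ell)` is `conjX g`-stable
  (abc-iut-L6-d5's `Thm16Sub.map_ker_toEll_eq` at `γ := conjX g`), so the image of `g b g⁻¹` in `(Π^tp_X)^ell` depends only
  on the image of `b`: conjugation by `Π^tp_C` DESCENDS to `(Δ^tp_Y)^ell`;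
* **`exists_mem_Huu_dtpY_toEll_eq_conjX`** — for `b ∈ Δ^tp_{Y̲̲} = Π^tp_X̲̲ ∩ Δ^tp_Y` and ANY `g ∈ Π^tp_C` there is
  `b′ ∈ Δ^tp_{Y̲̲}` with the same image in `(Π^tp_X)^ell` as `g b g⁻¹` — although `Π^tp_X̲̲` itself is NOT normal in `Π^tp_C`
  (`SettingModel.not_normal_Huuχ`): the subgroup `(Δ^tp_{Y̲̲})^ell` of nonzero index (`relIndex_Huu_dtpY_ne_zero`) in
  `(Δ^tp_Y)^ell ≅ Ẑ` (abc-iut-w5-d024/L2 `IsEtThOrigin.nonempty_dtpY_quotient_mulEquiv_zHat`, inputs `IsEtThOrigin`,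
  `hYcl`) is fixed by the automorphism induced by `conjX g` (gen 6's `ZHatLevels.map_mulEquiv_eq_of_mulEquiv_zHat`:
  finite-index subgroups of `Ẑ` are characteristic). This is the well-definedness of the `Π_C(M)`-action `actEll` on
  `Δ^ell_Y(M) = Δ^tp_{Y̲̲}/(Δ^tp_{Y̲̲} ∩ Ker ell)` of the typed record `FlSymmetry` (`MonoThetaSymmetries.lean`).

BINDER CENSUS: `cl : CLevelData` (parameter record), `hR1c`, `IsEtThOrigin`, `hYcl` — existing binders BY NAME; no `Prop`
fact introduced, no FACT-LIST row consumed. HONEST FRAMING: kernel facts about the cell's own typed interfaces; nothing of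
[EtTh]/[IUTchII] is asserted; Rmk. 1.1.1 is outside the [IUTchIII] Cor. 3.12 cone; no side taken on Cor. 3.12; typed ≠
proved.
-/

noncomputable section

namespace Literature.AnabelianGeometry.EtaleTheta

open Literature.AnabelianGeometry.SemiGraphs

variable {p : ℕ} [Fact p.Prime]

namespace MuTwoSetting.CLevelData

variable {M : MuTwoSetting p} (e : M.CLevelData)

/-- **Under (R1c), `Π^tp_Y = Ker(toZ)` is carried onto itself by every restricted inner automorphism of `Π^tp_C`**
(conjugation acts on `toZ` by `±1`). [cite: MochizukiEtTh2009, Def 2.5 p.39] -/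
theorem conjX_mem_GtpY_iff (hR1c : ∀ x : M.PiTemp, M.toZ (e.conjX M.epsPM x) = (M.toZ x)⁻¹) (g : M.GtpC)
    (y : M.PiTemp) : e.conjX g y ∈ M.GtpY ↔ y ∈ M.GtpY := by
  rw [ThetaSetting.GtpY, MonoidHom.mem_ker, MonoidHom.mem_ker]
  by_cases hg : g ∈ M.inclX.range
  · rw [e.toZ_conjX_of_mem_range hg]
  · rw [e.toZ_conjX_of_not_mem_range hR1c hg, inv_eq_one]

/-- **Under (R1c), `Δ^tp_Y = Π^tp_Y ∩ Δ^tp_X` is carried onto itself by every `conjX g`.**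
[cite: MochizukiEtTh2009, Def 2.5 p.39] -/
theorem conjX_mem_dtpY_iff (hR1c : ∀ x : M.PiTemp, M.toZ (e.conjX M.epsPM x) = (M.toZ x)⁻¹) (g : M.GtpC)
    (y : M.PiTemp) : e.conjX g y ∈ M.DtpY ↔ y ∈ M.DtpY := by
  rw [ThetaSetting.DtpY, Subgroup.mem_inf, Subgroup.mem_inf, e.conjX_mem_GtpY_iff hR1c,
    e.conjX_mem_deltaTemp_iff]

/-- **`Ker(Π^tp_X ↠ (Π^tp_X)^ell)` is stable under every `conjX g`** (`Thm16Sub.map_ker_toEll_eq` at `γ := conjX g`,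
which preserves `Δ^tp_X`). [cite: MochizukiEtTh2009, Thm 1.6 (ii) p.24] -/
theorem conjX_mem_ker_toEll {g : M.GtpC} {k : M.PiTemp} (hk : k ∈ (M.thetaToEll.comp M.toTheta).ker) :
    e.conjX g k ∈ (M.thetaToEll.comp M.toTheta).ker := by
  have h : e.conjX g k ∈ (M.thetaToEll.comp M.toTheta).ker.map (e.conjX g).toMulEquiv.toMonoidHom := ⟨k, hk, rfl⟩
  rwa [Thm16Sub.map_ker_toEll_eq M.toThetaSetting M.toThetaSetting (e.conjX g) (e.map_deltaTemp_conjX g)] at h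

/-- **Conjugation by `Π^tp_C` descends to `(Π^tp_X)^ell`**: the image of `g b g⁻¹` in `(Π^tp_X)^ell` depends only on
the image of `b`. [cite: MochizukiEtTh2009, Thm 1.6 (ii) p.24] -/
theorem toEll_conjX_eq_of_toEll_eq (g : M.GtpC) {b b' : M.PiTemp}
    (h : M.thetaToEll (M.toTheta b) = M.thetaToEll (M.toTheta b')) :
    M.thetaToEll (M.toTheta (e.conjX g b)) = M.thetaToEll (M.toTheta (e.conjX g b')) := by
  have hk : b⁻¹ * b' ∈ (M.thetaToEll.comp M.toTheta).ker := by
    rw [MonoidHom.mem_ker, MonoidHom.comp_apply, map_mul, map_inv, map_mul, map_inv, h, inv_mul_cancel]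
  have hk' := e.conjX_mem_ker_toEll (g := g) hk
  rw [MonoidHom.mem_ker, MonoidHom.comp_apply, map_mul, map_inv, map_mul, map_inv, map_mul, map_inv,
    inv_mul_eq_one] at hk'
  exact hk'

end MuTwoSetting.CLevelData

namespace ThetaSetting.EtaleThetaData.DoubleUnderline

open ZHatLevels

variable {Mt : MuTwoSetting p} {E : Mt.toThetaSetting.EtaleThetaData} {l : ℕ} (C : E.DoubleUnderline l)

/-- **`Π^tp_C` acts on `Δ^ell_Y(M) = (Δ^tp_{Y̲̲})^ell`.** For every `g ∈ Π^tp_C` and `b ∈ Δ^tp_{Y̲̲} = Π^tp_X̲̲ ∩ Δ^tp_Y`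
there is `b′ ∈ Δ^tp_{Y̲̲}` whose image in `(Π^tp_X)^ell` is that of `g b g⁻¹`: the finite-index subgroup
`(Δ^tp_{Y̲̲})^ell` («`Y̲̲ → Y` of degree `l`», p. 41) of `(Δ^tp_Y)^ell ≅ Ẑ` (p. 13) is fixed by the automorphism of
`(Δ^tp_Y)^ell` induced by `conjX g` (finite-index subgroups of `Ẑ` are characteristic). Inputs BY NAME: the (R1c) clause
`hR1c`, `IsEtThOrigin`, `hYcl`. [cite: MochizukiEtTh2009, Def 2.7 p.41] -/
theorem exists_mem_Huu_dtpY_toEll_eq_conjX (cl : Mt.CLevelData) (hO : Mt.toThetaSetting.IsEtThOrigin)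
    (hYcl : (Mt.DtpY.map Mt.toHat.toMonoidHom).topologicalClosure ≤
      Mt.DtpY.map Mt.toHat.toMonoidHom ⊔ (⁅⁅Mt.DeltaHat, Mt.DeltaHat⁆, Mt.DeltaHat⁆).topologicalClosure)
    (hR1c : ∀ x : Mt.PiTemp, Mt.toZ (cl.conjX Mt.epsPM x) = (Mt.toZ x)⁻¹) (g : Mt.GtpC)
    {b : Mt.PiTemp} (hb : b ∈ C.Huu ⊓ Mt.DtpY) :
    ∃ b' ∈ C.Huu ⊓ Mt.DtpY,
      Mt.thetaToEll (Mt.toTheta b') = Mt.thetaToEll (Mt.toTheta (cl.conjX g b)) := by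
  classical
  -- ### `(Δ^tp_Y)^ell` as the quotient `Δ^tp_Y / (Δ^tp_Y ∩ Ker ell) ≅ Ẑ`
  set K : Subgroup ↥Mt.DtpY := (Mt.thetaToEll.comp Mt.toTheta).ker.subgroupOf Mt.DtpY with hKdef
  haveI hKn : K.Normal := by
    rw [hKdef]
    exact Subgroup.Normal.subgroupOf (MonoidHom.normal_ker _) _
  obtain ⟨eQ⟩ := hO.nonempty_dtpY_quotient_mulEquiv_zHat Mt.toThetaSetting hYcl
  -- ### the automorphism of `Δ^tp_Y` induced by `conjX g`, and the induced automorphism `ψ` of the quotient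
  let ec : ↥Mt.DtpY ≃* ↥Mt.DtpY :=
    { toFun := fun y => ⟨cl.conjX g y, (cl.conjX_mem_dtpY_iff hR1c g _).2 y.2⟩
      invFun := fun y => ⟨cl.conjX g⁻¹ y, (cl.conjX_mem_dtpY_iff hR1c g⁻¹ _).2 y.2⟩
      left_inv := fun y => Subtype.ext (by
        change cl.conjX g⁻¹ (cl.conjX g y) = y
        rw [← cl.conjX_mul, inv_mul_cancel, cl.conjX_one])
      right_inv := fun y => Subtype.ext (by
        change cl.conjX g (cl.conjX g⁻¹ y) = y
        rw [← cl.conjX_mul, mul_inv_cancel, cl.conjX_one])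
      map_mul' := fun x y => Subtype.ext (map_mul (cl.conjX g) _ _) }
  have hec : ∀ y : ↥Mt.DtpY, ((ec y : ↥Mt.DtpY) : Mt.PiTemp) = cl.conjX g y := fun _ => rfl
  have hmemK : ∀ y : ↥Mt.DtpY, y ∈ K ↔ (y : Mt.PiTemp) ∈ (Mt.thetaToEll.comp Mt.toTheta).ker := fun y => by
    rw [hKdef, Subgroup.mem_subgroupOf]
  have hK : K.map (ec : ↥Mt.DtpY →* ↥Mt.DtpY) = K := by
    ext y
    rw [Subgroup.mem_map]
    constructor
    · rintro ⟨x, hx, rfl⟩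
      rw [hmemK] at hx ⊢
      exact cl.conjX_mem_ker_toEll hx
    · intro hy
      refine ⟨ec.symm y, ?_, ec.apply_symm_apply y⟩
      rw [hmemK] at hy ⊢
      exact cl.conjX_mem_ker_toEll hy
  let ψ : ↥Mt.DtpY ⧸ K ≃* ↥Mt.DtpY ⧸ K := QuotientGroup.congr K K ec hK
  -- ### the image `H` of `Δ^tp_{Y̲̲}` in the quotient has nonzero index, hence is `ψ`-stable
  set H : Subgroup (↥Mt.DtpY ⧸ K) := (C.Huu.subgroupOf Mt.DtpY).map (QuotientGroup.mk' K) with hHdef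
  have hH : 0 < H.index := by
    have hdvd : H.index ∣ (C.Huu.subgroupOf Mt.DtpY).index :=
      Subgroup.index_map_dvd _ (QuotientGroup.mk'_surjective K)
    have hne : (C.Huu.subgroupOf Mt.DtpY).index ≠ 0 := C.relIndex_Huu_dtpY_ne_zero
    refine Nat.pos_of_ne_zero fun h0 => hne ?_
    rw [h0] at hdvd
    exact Nat.eq_zero_of_zero_dvd hdvd
  have hmap := map_mulEquiv_eq_of_mulEquiv_zHat eQ ψ H hH
  -- ### chase the class of `b`
  have hbH : (QuotientGroup.mk' K (⟨b, hb.2⟩ : ↥Mt.DtpY)) ∈ H :=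
    ⟨⟨b, hb.2⟩, Subgroup.mem_subgroupOf.2 hb.1, rfl⟩
  have hψb : ψ (QuotientGroup.mk' K (⟨b, hb.2⟩ : ↥Mt.DtpY)) ∈ H := by
    rw [← hmap]
    exact ⟨_, hbH, rfl⟩
  obtain ⟨y, hy, hyeq⟩ := hψb
  refine ⟨(y : Mt.PiTemp), ⟨Subgroup.mem_subgroupOf.1 hy, y.2⟩, ?_⟩
  have h2 : (QuotientGroup.mk' K y) = QuotientGroup.mk' K (ec ⟨b, hb.2⟩) := by
    rw [hyeq, QuotientGroup.mk'_apply, QuotientGroup.mk'_apply]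
    exact QuotientGroup.congr_mk K K ec hK _
  rw [QuotientGroup.mk'_eq_mk', ] at h2
  obtain ⟨k, hk, hyk⟩ := h2
  rw [hmemK] at hk
  have hval : cl.conjX g b = (y : Mt.PiTemp) * (k : Mt.PiTemp) := by
    rw [← hec ⟨b, hb.2⟩, ← hyk]
    rfl
  rw [hval, map_mul, map_mul]
  have hk1 : Mt.thetaToEll (Mt.toTheta (k : Mt.PiTemp)) = 1 := hk
  rw [hk1, mul_one]

end ThetaSetting.EtaleThetaData.DoubleUnderline

end Literature.AnabelianGeometry.EtaleTheta

end
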